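import Mathlib
import HarnessLib
import Literature.Probability.LatticeModels.IsingLimitLaw
import Literature.Probability.LatticeModels.IsingLimitLawTilt
import Literature.Probability.LatticeModels.IsingLimitLawLaplace
import Literature.Analysis.Complex.PolyaBesselKernel
import Summits.RiemannHypothesis.RiemannHypothesis.Theorems.LeeYangLeeyangPolyaKernelIsingLimitDefs

/-!
# Cone invariant and growth bound of the real transfer recursion: stub `stub_cone` of the line
`telegraph-bessel-chain` (crux stmt-RiemannHypothesis-0453)

For REAL `z = h ≥ 0`, constant weight `η > 0` and bond parameters `c m ∈ [0, 1]` the transfer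
recursion `X_m = (S_m, D_m) = sdIter h (fun _ => η) c m` of the open Ising chain (whose first
component is twice the Laplace transform `E e^{hM}` of the magnetisation, stub `stub_transfer`)
has real entries, `S_m > 0`, and satisfies the growth bound
`S_M ≤ 2 exp((M + 1) x² / 2 + x Σ_{m<M} κ_m)`, `x = h η`, for every profile `κ_m ∈ [0, 1]` with
`min(1, x) ≤ κ_0` and, for each `m`, either `κ_{m+1} = 1` or (`κ_m ≤ κ_{m+1}` and
`2x ≤ (1 - c_m) κ_{m+1}`).

The argument (elementary real analysis, one induction on `m`): the CONE `|D_m| ≤ κ_m S_m`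
propagates along `S⁺ = cosh x · S + c sinh x · D`, `D⁺ = sinh x · S + c cosh x · D`
(base: `tanh x ≤ min(1, x)`; step `κ⁺ = 1`: `S⁺ ∓ D⁺ = e^{∓x}(S ∓ cD) ≥ 0`; step
`2x ≤ (1 - c)κ⁺`: `sinh x (1 + cκ⁺) ≤ 2x cosh x ≤ κ⁺(1 - c) cosh x`), and inside the cone each
step multiplies `S` by at most `cosh x + c κ sinh x ≤ cosh x (1 + κ x) ≤ e^{x²/2} e^{κ x}`
(`Real.cosh_le_exp_half_sq`, `sinh x ≤ x cosh x`, `1 + y ≤ e^y`). Folklore (transfer matrices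
of one-dimensional Ising chains); no statement of the literature is used.
-/

noncomputable section

namespace Summit.RiemannHypothesis.RiemannHypothesis.Theorems.LeeYangTelegraph

open MeasureTheory Filter Topology Complex
open Literature.Probability.LatticeModels Literature.Analysis.Complex.Polya1926

/-- `sinh x ≤ x cosh x` for `x ≥ 0` (the derivative of `x cosh x - sinh x` is `x sinh x ≥ 0`).
[folklore] -/
private theorem sinh_le_self_mul_cosh_of_nonneg {x : ℝ} (hx : 0 ≤ x) :
    Real.sinh x ≤ x * Real.cosh x := by
  have hd : ∀ t : ℝ, HasDerivAt (fun t : ℝ => t * Real.cosh t - Real.sinh t)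
      (1 * Real.cosh t + t * Real.sinh t - Real.cosh t) t := fun t =>
    ((hasDerivAt_id t).mul (Real.hasDerivAt_cosh t)).sub (Real.hasDerivAt_sinh t)
  have hmono : MonotoneOn (fun t : ℝ => t * Real.cosh t - Real.sinh t) (Set.Ici 0) := by
    refine monotoneOn_of_deriv_nonneg (convex_Ici 0) ?_ ?_ fun t ht => ?_
    · exact ((continuous_id.mul Real.continuous_cosh).sub Real.continuous_sinh).continuousOn
    · exact fun t _ => (hd t).differentiableAt.differentiableWithinAt
    · rw [interior_Ici, Set.mem_Ioi] at ht
      rw [(hd t).deriv]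
      have : 0 ≤ t * Real.sinh t := mul_nonneg ht.le (Real.sinh_nonneg_iff.2 ht.le)
      linarith
  have := hmono (Set.mem_Ici.2 le_rfl) (Set.mem_Ici.2 hx) hx
  simp only [zero_mul, Real.sinh_zero, sub_zero] at this
  linarith

/-- Base of the cone invariant: `|2 sinh x| ≤ κ₀ · 2 cosh x` whenever `min(1, x) ≤ κ₀`, `x ≥ 0`
(`tanh x ≤ 1` and `tanh x ≤ x`). [folklore] -/
private theorem cone_base {x κ₀ : ℝ} (hx : 0 ≤ x) (hbase : min 1 x ≤ κ₀) :
    |2 * Real.sinh x| ≤ κ₀ * (2 * Real.cosh x) := by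
  have hsh : 0 ≤ Real.sinh x := Real.sinh_nonneg_iff.2 hx
  have hch : 0 < Real.cosh x := Real.cosh_pos x
  rw [abs_of_nonneg (by linarith)]
  suffices Real.sinh x ≤ κ₀ * Real.cosh x by linarith
  rcases min_le_iff.1 hbase with h1 | h1
  · calc Real.sinh x ≤ Real.cosh x := (Real.sinh_lt_cosh x).le
      _ = 1 * Real.cosh x := (one_mul _).symm
      _ ≤ κ₀ * Real.cosh x := mul_le_mul_of_nonneg_right h1 hch.le
  · calc Real.sinh x ≤ x * Real.cosh x := sinh_le_self_mul_cosh_of_nonneg hx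
      _ ≤ κ₀ * Real.cosh x := mul_le_mul_of_nonneg_right h1 hch.le

/-- One step of the cone invariant for the real recursion `S⁺ = cosh x · S + c sinh x · D`,
`D⁺ = sinh x · S + c cosh x · D` (`x ≥ 0`, `c, κ, κ⁺ ∈ [0, 1]`): if `S > 0`, `|D| ≤ κ S` and
either `κ⁺ = 1` or (`κ ≤ κ⁺` and `2x ≤ (1 - c) κ⁺`), then `S⁺ > 0`, `|D⁺| ≤ κ⁺ S⁺` and
`S⁺ ≤ S · exp(x²/2 + κ x)`. [folklore] -/
private theorem cone_step (x S D cc κ κ' : ℝ) (hx : 0 ≤ x) (hS : 0 < S) (hD : |D| ≤ κ * S)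
    (hcc : 0 ≤ cc ∧ cc ≤ 1) (hκ : 0 ≤ κ ∧ κ ≤ 1) (hκ' : 0 ≤ κ' ∧ κ' ≤ 1)
    (hstep : κ' = 1 ∨ (κ ≤ κ' ∧ 2 * x ≤ (1 - cc) * κ')) :
    0 < Real.cosh x * S + cc * Real.sinh x * D ∧
    |Real.sinh x * S + cc * Real.cosh x * D| ≤ κ' * (Real.cosh x * S + cc * Real.sinh x * D) ∧
    Real.cosh x * S + cc * Real.sinh x * D ≤ S * Real.exp (x ^ 2 / 2 + κ * x) := by
  obtain ⟨hD1, hD2⟩ := abs_le.1 hD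
  have hch : 0 < Real.cosh x := Real.cosh_pos x
  have hsh : 0 ≤ Real.sinh x := Real.sinh_nonneg_iff.2 hx
  have hlt : Real.sinh x < Real.cosh x := Real.sinh_lt_cosh x
  have hshx : Real.sinh x ≤ x * Real.cosh x := sinh_le_self_mul_cosh_of_nonneg hx
  have hκS : κ * S ≤ S := by nlinarith
  have hDS1 : -S ≤ D := by linarith
  have hDS2 : D ≤ S := by linarith
  set ch := Real.cosh x with hch_def
  set sh := Real.sinh x with hsh_def
  -- positivity: `S⁺ ≥ (cosh x - sinh x) S = e^{-x} S > 0`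
  have hlow : (ch - sh) * S ≤ ch * S + cc * sh * D := by
    have h1 : cc * sh * (-S) ≤ cc * sh * D := mul_le_mul_of_nonneg_left hDS1 (mul_nonneg hcc.1 hsh)
    have h2 : cc * (sh * S) ≤ 1 * (sh * S) :=
      mul_le_mul_of_nonneg_right hcc.2 (mul_nonneg hsh hS.le)
    nlinarith
  have hpos : 0 < ch * S + cc * sh * D := lt_of_lt_of_le (mul_pos (sub_pos.2 hlt) hS) hlow
  refine ⟨hpos, ?_, ?_⟩
  · rcases hstep with hk1 | ⟨hkk, h2x⟩
    · -- case `κ⁺ = 1`: `S⁺ ± D⁺ = e^{±x} (S ± c D) ≥ 0`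
      subst hk1
      rw [one_mul, abs_le]
      constructor
      · have h1 : 0 ≤ S + cc * D := by
          have := mul_le_mul_of_nonneg_left hDS1 hcc.1
          nlinarith [mul_nonneg (sub_nonneg.2 hcc.2) hS.le]
        have h2 : 0 ≤ (ch + sh) * (S + cc * D) := mul_nonneg (by linarith) h1
        nlinarith
      · have h1 : 0 ≤ S - cc * D := by
          have := mul_le_mul_of_nonneg_left hDS2 hcc.1
          nlinarith [mul_nonneg (sub_nonneg.2 hcc.2) hS.le]
        have h2 : 0 ≤ (ch - sh) * (S - cc * D) := mul_nonneg (sub_nonneg.2 hlt.le) h1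
        nlinarith
    · -- case `κ ≤ κ⁺`, `2x ≤ (1 - c) κ⁺`
      have hkey : sh + cc * ch * κ + κ' * (cc * sh * κ) ≤ κ' * ch := by
        have h1 : cc * κ * ch ≤ cc * κ' * ch :=
          mul_le_mul_of_nonneg_right (mul_le_mul_of_nonneg_left hkk hcc.1) hch.le
        have h2 : κ' * (cc * sh * κ) ≤ κ' * (cc * sh * 1) :=
          mul_le_mul_of_nonneg_left (mul_le_mul_of_nonneg_left hκ.2 (mul_nonneg hcc.1 hsh)) hκ'.1
        have h3 : sh * (1 + cc * κ') ≤ sh * 2 :=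
          mul_le_mul_of_nonneg_left (by linarith [mul_le_one₀ hcc.2 hκ'.1 hκ'.2]) hsh
        have h4 : 2 * x * ch ≤ (1 - cc) * κ' * ch := mul_le_mul_of_nonneg_right h2x hch.le
        nlinarith
      have hup : sh * S + cc * ch * D ≤ sh * S + cc * ch * (κ * S) := by
        have := mul_le_mul_of_nonneg_left hD2 (mul_nonneg hcc.1 hch.le)
        linarith
      have hdown : -(sh * S + cc * ch * D) ≤ sh * S + cc * ch * (κ * S) := by
        have := mul_le_mul_of_nonneg_left hD1 (mul_nonneg hcc.1 hch.le)
        have : 0 ≤ sh * S := mul_nonneg hsh hS.le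
        linarith
      have hS'low : κ' * (ch * S - cc * sh * (κ * S)) ≤ κ' * (ch * S + cc * sh * D) := by
        apply mul_le_mul_of_nonneg_left _ hκ'.1
        have := mul_le_mul_of_nonneg_left hD1 (mul_nonneg hcc.1 hsh)
        linarith
      have hmid : sh * S + cc * ch * (κ * S) ≤ κ' * (ch * S - cc * sh * (κ * S)) := by
        have := mul_le_mul_of_nonneg_right hkey hS.le
        nlinarith
      rw [abs_le]
      constructor <;> linarith
  · -- growth: `S⁺ ≤ S (cosh x + c κ sinh x) ≤ S cosh x (1 + κ x) ≤ S e^{x²/2} e^{κ x}`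
    have h1 : cc * sh * D ≤ cc * sh * (κ * S) :=
      mul_le_mul_of_nonneg_left hD2 (mul_nonneg hcc.1 hsh)
    have h2 : cc * (sh * (κ * S)) ≤ 1 * (sh * (κ * S)) :=
      mul_le_mul_of_nonneg_right hcc.2 (mul_nonneg hsh (mul_nonneg hκ.1 hS.le))
    have h3 : sh * (κ * S) ≤ x * ch * (κ * S) :=
      mul_le_mul_of_nonneg_right hshx (mul_nonneg hκ.1 hS.le)
    have h4 : ch ≤ Real.exp (x ^ 2 / 2) := Real.cosh_le_exp_half_sq x
    have h5 : 1 + κ * x ≤ Real.exp (κ * x) := by linarith [Real.add_one_le_exp (κ * x)]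
    have h6 : 0 ≤ 1 + κ * x := by nlinarith
    calc ch * S + cc * sh * D ≤ ch * S * (1 + κ * x) := by nlinarith
      _ ≤ Real.exp (x ^ 2 / 2) * S * Real.exp (κ * x) :=
          mul_le_mul (mul_le_mul_of_nonneg_right h4 hS.le) h5 h6
            (mul_nonneg (Real.exp_pos _).le hS.le)
      _ = S * Real.exp (x ^ 2 / 2 + κ * x) := by rw [Real.exp_add]; ring

/-- The cone invariant and the growth bound along the whole real recursion: for real sequences
`s, d` with `s₀ = 2 cosh x`, `d₀ = 2 sinh x`, `s_{m+1} = cosh x · s_m + c_m sinh x · d_m`,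
`d_{m+1} = sinh x · s_m + c_m cosh x · d_m` and an admissible profile `κ`, one has `s_M > 0`,
`|d_M| ≤ κ_M s_M` and `s_M ≤ 2 cosh x · exp(M x²/2 + x Σ_{m<M} κ_m)`. [folklore] -/
private theorem cone_iter (x : ℝ) (hx : 0 ≤ x) (c κ : ℕ → ℝ)
    (hc : ∀ m, 0 ≤ c m ∧ c m ≤ 1) (hκ : ∀ m, 0 ≤ κ m ∧ κ m ≤ 1)
    (hbase : min 1 x ≤ κ 0)
    (hstep : ∀ m, κ (m + 1) = 1 ∨ (κ m ≤ κ (m + 1) ∧ 2 * x ≤ (1 - c m) * κ (m + 1)))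
    (s d : ℕ → ℝ) (hs0 : s 0 = 2 * Real.cosh x) (hd0 : d 0 = 2 * Real.sinh x)
    (hs : ∀ m, s (m + 1) = Real.cosh x * s m + c m * Real.sinh x * d m)
    (hd : ∀ m, d (m + 1) = Real.sinh x * s m + c m * Real.cosh x * d m) (M : ℕ) :
    0 < s M ∧ |d M| ≤ κ M * s M ∧
      s M ≤ 2 * Real.cosh x * Real.exp (M * (x ^ 2 / 2) + x * ∑ m ∈ Finset.range M, κ m) := by
  induction M with
  | zero =>
    refine ⟨?_, ?_, ?_⟩
    · rw [hs0]; exact mul_pos two_pos (Real.cosh_pos x)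
    · rw [hs0, hd0]; exact cone_base hx hbase
    · simp [hs0]
  | succ M ih =>
    obtain ⟨hpos, hcone, hbd⟩ := ih
    obtain ⟨hpos', hcone', hgr⟩ := cone_step x (s M) (d M) (c M) (κ M) (κ (M + 1)) hx hpos hcone
      (hc M) (hκ M) (hκ (M + 1)) (hstep M)
    rw [hs M, hd M]
    refine ⟨hpos', hcone', hgr.trans ?_⟩
    calc s M * Real.exp (x ^ 2 / 2 + κ M * x)
        ≤ 2 * Real.cosh x * Real.exp (M * (x ^ 2 / 2) + x * ∑ m ∈ Finset.range M, κ m) *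
            Real.exp (x ^ 2 / 2 + κ M * x) :=
          mul_le_mul_of_nonneg_right hbd (Real.exp_pos _).le
      _ = 2 * Real.cosh x *
            Real.exp (((M + 1 : ℕ) : ℝ) * (x ^ 2 / 2) + x * ∑ m ∈ Finset.range (M + 1), κ m) := by
          rw [mul_assoc (2 * Real.cosh x), ← Real.exp_add, Finset.sum_range_succ]
          congr 1
          push_cast
          ring

/-- For real data `z = h`, constant weight `η` and real bond parameters `c m`, the transfer
recursion `sdIter` is real: there are real sequences `s, d` with `sdIter h η c m = (s m, d m)`,
satisfying the real recursion `s₀ = 2 cosh x`, `d₀ = 2 sinh x`,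
`s_{m+1} = cosh x · s_m + c_m sinh x · d_m`, `d_{m+1} = sinh x · s_m + c_m cosh x · d_m`,
`x = h η`. [folklore] -/
private theorem sdIter_real (h η : ℝ) (c : ℕ → ℝ) :
    ∃ s d : ℕ → ℝ, s 0 = 2 * Real.cosh (h * η) ∧ d 0 = 2 * Real.sinh (h * η) ∧
      (∀ m, s (m + 1) = Real.cosh (h * η) * s m + c m * Real.sinh (h * η) * d m) ∧
      (∀ m, d (m + 1) = Real.sinh (h * η) * s m + c m * Real.cosh (h * η) * d m) ∧
      ∀ m, sdIter (h : ℂ) (fun _ => η) c m = ((s m : ℂ), (d m : ℂ)) := by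
  -- the real recursion, as a function `ℕ → ℝ × ℝ`
  let F : ℕ → ℝ × ℝ := fun m => Nat.rec (2 * Real.cosh (h * η), 2 * Real.sinh (h * η))
    (fun m X => (Real.cosh (h * η) * X.1 + c m * Real.sinh (h * η) * X.2,
      Real.sinh (h * η) * X.1 + c m * Real.cosh (h * η) * X.2)) m
  refine ⟨fun m => (F m).1, fun m => (F m).2, rfl, rfl, fun m => rfl, fun m => rfl, ?_⟩
  have hx : (h : ℂ) * (η : ℂ) = ((h * η : ℝ) : ℂ) := by push_cast; ring
  intro m
  induction m with
  | zero =>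
    show _ = (((2 * Real.cosh (h * η) : ℝ) : ℂ), ((2 * Real.sinh (h * η) : ℝ) : ℂ))
    rw [sdIter, hx]
    push_cast
    rfl
  | succ m ih =>
    show _ = (((Real.cosh (h * η) * (F m).1 + c m * Real.sinh (h * η) * (F m).2 : ℝ) : ℂ),
      ((Real.sinh (h * η) * (F m).1 + c m * Real.cosh (h * η) * (F m).2 : ℝ) : ℂ))
    rw [sdIter, ih, hx]
    refine Prod.ext ?_ ?_ <;> simp only [sdStep] <;> push_cast <;> ring

/-- **Cone invariant and growth bound** (stub `stub_cone`). For real `h ≥ 0`, constant weight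
`η > 0`, bond parameters `c m ∈ [0, 1]` and a profile `κ m ∈ [0, 1]` with `min(1, hη) ≤ κ 0` and,
for every `m`, `κ (m+1) = 1` or (`κ m ≤ κ (m+1)` and `2hη ≤ (1 - c m) κ (m+1)`), the first
component `S_M` of the transfer recursion `sdIter h (fun _ => η) c M` is real, positive, and
`S_M ≤ 2 exp((M + 1)(hη)²/2 + hη Σ_{m<M} κ m)`. [folklore] -/
theorem stub_cone (h η : ℝ) (hh : 0 ≤ h) (hη : 0 < η) (c κ : ℕ → ℝ)
    (hc : ∀ m, 0 ≤ c m ∧ c m ≤ 1) (hκ : ∀ m, 0 ≤ κ m ∧ κ m ≤ 1)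
    (hbase : min 1 (h * η) ≤ κ 0)
    (hstep : ∀ m, κ (m + 1) = 1 ∨ (κ m ≤ κ (m + 1) ∧ 2 * h * η ≤ (1 - c m) * κ (m + 1)))
    (M : ℕ) :
    (sdIter (h : ℂ) (fun _ => η) c M).1.im = 0 ∧
    0 < (sdIter (h : ℂ) (fun _ => η) c M).1.re ∧
    (sdIter (h : ℂ) (fun _ => η) c M).1.re ≤
      2 * Real.exp ((M + 1) * (h * η) ^ 2 / 2 + h * η * ∑ m ∈ Finset.range M, κ m) := by
  obtain ⟨s, d, hs0, hd0, hs, hd, he⟩ := sdIter_real h η c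
  have hstep' : ∀ m, κ (m + 1) = 1 ∨
      (κ m ≤ κ (m + 1) ∧ 2 * (h * η) ≤ (1 - c m) * κ (m + 1)) := fun m => by
    simpa only [mul_assoc] using hstep m
  obtain ⟨hpos, -, hbd⟩ := cone_iter (h * η) (mul_nonneg hh hη.le) c κ hc hκ hbase hstep'
    s d hs0 hd0 hs hd M
  rw [he M]
  simp only [ofReal_im, ofReal_re, true_and]
  refine ⟨hpos, hbd.trans ?_⟩
  calc 2 * Real.cosh (h * η) *
        Real.exp (M * ((h * η) ^ 2 / 2) + h * η * ∑ m ∈ Finset.range M, κ m)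
      ≤ 2 * Real.exp ((h * η) ^ 2 / 2) *
        Real.exp (M * ((h * η) ^ 2 / 2) + h * η * ∑ m ∈ Finset.range M, κ m) :=
        mul_le_mul_of_nonneg_right
          (mul_le_mul_of_nonneg_left (Real.cosh_le_exp_half_sq _) zero_le_two) (Real.exp_pos _).le
    _ = 2 * Real.exp ((M + 1) * (h * η) ^ 2 / 2 + h * η * ∑ m ∈ Finset.range M, κ m) := by
        rw [mul_assoc, ← Real.exp_add]
        congr 1
        ring

end Summit.RiemannHypothesis.RiemannHypothesis.Theorems.LeeYangTelegraph

end
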